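import Literature.NumberTheory.Sieve.PolymathGEHPolyEval
import Mathlib.MeasureTheory.Constructions.Pi
import Mathlib.MeasureTheory.Integral.Prod
import Mathlib.MeasureTheory.Measure.Lebesgue.EqHaar
import HarnessLib

/-!
# Graph-structured cells in `ℝ³` and their exact integrals (tooling for Polymath 8b, Theorem 3.15)

Trunk AntSieve, second tooling file (after `PolymathGEHPolyEval.lean`) for the numerical
**Theorem 3.15** of D. H. J. Polymath, *Variants of the Selberg sieve, and bounded intervals
containing many primes*, Res. Math. Sci. 1:12 (2014) = arXiv:1407.4897 (§7.4, pp. 31–34), the last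
ingredient of the printed proof of Theorem 3.2(xii) (`GEH ⟹ DHL[3,2]`, the named fact
`Literature.NumberTheory.Sieve.weakDHL_three_two_of_GEH`).  §7.4 decomposes `(3/2)·R₃` into
polytopes with the "graph structure" `{(x,y) ∈ Q, a(x,y) < z < b(x,y)}` (display (graph)) and
evaluates `I(F↾P)` by the displayed threefold iterated integrals.  This file turns such an iterated
description into a Lean object and proves, once and for all, that the Lebesgue integral over the cell
is the exact rational number computed by `GEHCutoff.cellIntegral`:

* `GEHCutoff.Aff1`, `GEHCutoff.Aff2` — affine bounds with rational coefficients;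
* `GEHCutoff.GCell` — a cell `{a₀ ≶ t_i ≶ a₁, l₁(t_i) ≶ t_mid ≶ h₁(t_i), l₂ ≶ t_inn ≶ h₂}` with an
  arbitrary order `(i, mid, inn)` of the three coordinates, open or closed (`GCell.set closed`), its
  Boolean well-formedness test `GCell.wf` (orientation of the bounds, checked at the corners) and its
  exact integral `GCell.integral q` of a `Q3` polynomial `q` (in the cell's variable order);
* `GCell.integral_indicator_eq` — **Fubini**: `∫_{ℝ³} 1_cell · q = GCell.integral q` (for well-formed
  cells, open or closed), via `MeasurableEquiv.piFinSuccAbove` twice and `MeasurableEquiv.funUnique`;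
* three further generic tools: `integral_comp_perm` (permuting coordinates preserves integrals on
  `ℝ³`), `volume_line_eq_zero` (lines are null in `ℝ²`, for the "almost every `(t₁, t₂)`" form of the
  vanishing marginal conditions (7.12)–(7.17)), and `setIntegral_Ioi_eq_sum_of_piecewise` (a fibre
  integral `∫_{u>0} F(x,y,u) du` from a piecewise description, the shape of the displays `J₁`–`J₈`).

No number theory; the point is that everything downstream reduces to closed `ℚ`-terms (`decide`).

## References

* [Polymath8b2014] D. H. J. Polymath, Res. Math. Sci. 1 (2014), Art. 12 = arXiv:1407.4897, §7.4
  (pp. 31–34), Theorem 3.15.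
-/

noncomputable section

open MeasureTheory intervalIntegral

namespace Literature.NumberTheory.Sieve

namespace GEHCutoff

open Set

/-! ### Joint continuity of the evaluations -/

variable {α : Type}

/-- `leval` is jointly continuous in (continuously varying) coefficients and point. [folklore] -/
theorem continuous_leval_comp {X : Type*} [TopologicalSpace X] {ev : X → α → ℝ}
    (hev : ∀ c, Continuous fun x => ev x c) {w : X → ℝ} (hw : Continuous w) :
    ∀ l : List α, Continuous fun x => leval (ev x) l (w x)
  | [] => continuous_const
  | c :: l => by
    simp only [leval_cons]
    exact (hev c).add (hw.mul (continuous_leval_comp hev hw l))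

/-- `x ↦ ev1 (u x) p` is continuous. [folklore] -/
theorem continuous_ev1_comp {X : Type*} [TopologicalSpace X] {u : X → ℝ} (hu : Continuous u) (p : Q1) :
    Continuous fun x => ev1 (u x) p :=
  continuous_leval_comp (ev := fun (_ : X) (q : ℚ) => (q : ℝ)) (fun _ => continuous_const) hu p

/-- `x ↦ ev2 (u x) (v x) p` is continuous. [folklore] -/
theorem continuous_ev2_comp {X : Type*} [TopologicalSpace X] {u v : X → ℝ} (hu : Continuous u)
    (hv : Continuous v) (p : Q2) : Continuous fun x => ev2 (u x) (v x) p :=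
  continuous_leval_comp (fun c => continuous_ev1_comp hu c) hv p

/-- `x ↦ ev3 (u x) (v x) (w x) p` is continuous. [folklore] -/
theorem continuous_ev3_comp {X : Type*} [TopologicalSpace X] {u v w : X → ℝ} (hu : Continuous u)
    (hv : Continuous v) (hw : Continuous w) (p : Q3) : Continuous fun x => ev3 (u x) (v x) (w x) p :=
  continuous_leval_comp (fun c => continuous_ev2_comp hu hv c) hw p

/-! ### Affine bounds with rational coefficients -/

/-- An affine function `u ↦ c₀ + c₁ u` with rational coefficients. [folklore] -/
structure Aff1 where
  /-- constant coefficient -/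
  c0 : ℚ
  /-- coefficient of `u` -/
  c1 : ℚ
deriving DecidableEq

/-- An affine function `(u, v) ↦ c₀ + c₁ u + c₂ v` with rational coefficients. [folklore] -/
structure Aff2 where
  /-- constant coefficient -/
  c0 : ℚ
  /-- coefficient of `u` -/
  c1 : ℚ
  /-- coefficient of `v` -/
  c2 : ℚ
deriving DecidableEq

namespace Aff1

/-- Real value. [folklore] -/
def val (a : Aff1) (u : ℝ) : ℝ := a.c0 + a.c1 * u

/-- Rational value at a rational point. [folklore] -/
def qval (a : Aff1) (u : ℚ) : ℚ := a.c0 + a.c1 * u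

/-- As a `Q1` polynomial. [folklore] -/
def toQ1 (a : Aff1) : Q1 := [a.c0, a.c1]

/-- `ev1` of `toQ1` is the value. [folklore] -/
@[simp] theorem ev1_toQ1 (a : Aff1) (u : ℝ) : ev1 u a.toQ1 = a.val u := by
  simp [toQ1, ev1, val, mul_comm]

/-- Values at rational points. [folklore] -/
theorem val_cast (a : Aff1) (u : ℚ) : a.val u = (a.qval u : ℝ) := by
  simp [val, qval]

/-- `val` is continuous. [folklore] -/
theorem continuous_val (a : Aff1) : Continuous a.val :=
  continuous_const.add (continuous_const.mul continuous_id)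

end Aff1

namespace Aff2

/-- Real value. [folklore] -/
def val (a : Aff2) (u v : ℝ) : ℝ := a.c0 + a.c1 * u + a.c2 * v

/-- Rational value at a rational point. [folklore] -/
def qval (a : Aff2) (u v : ℚ) : ℚ := a.c0 + a.c1 * u + a.c2 * v

/-- As a `Q2` polynomial. [folklore] -/
def toQ2 (a : Aff2) : Q2 := [[a.c0, a.c1], [a.c2]]

/-- `ev2` of `toQ2` is the value. [folklore] -/
@[simp] theorem ev2_toQ2 (a : Aff2) (u v : ℝ) : ev2 u v a.toQ2 = a.val u v := by
  simp [toQ2, ev2, ev1, val]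
  ring

/-- Values at rational points. [folklore] -/
theorem val_cast (a : Aff2) (u v : ℚ) : a.val u v = (a.qval u v : ℝ) := by
  simp [val, qval]

end Aff2

/-- An affine function of `v ∈ [p, q]` lies between its endpoint values. [folklore] -/
theorem min_le_affine {A B p q v : ℝ} (hp : p ≤ v) (hq : v ≤ q) :
    min (A + B * p) (A + B * q) ≤ A + B * v := by
  rcases le_total 0 B with hB | hB
  · exact (min_le_left _ _).trans (by nlinarith)
  · exact (min_le_right _ _).trans (by nlinarith)

/-- An affine function of `v ∈ [p, q]` lies between its endpoint values. [folklore] -/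
theorem affine_le_max {A B p q v : ℝ} (hp : p ≤ v) (hq : v ≤ q) :
    A + B * v ≤ max (A + B * p) (A + B * q) := by
  rcases le_total 0 B with hB | hB
  · exact le_trans (by nlinarith) (le_max_right _ _)
  · exact le_trans (by nlinarith) (le_max_left _ _)

/-! ### Graph-structured cells -/

/-- Strict or non-strict comparison. [folklore] -/
def rel (closed : Bool) (a b : ℝ) : Prop := if closed then a ≤ b else a < b

/-- `rel` implies `≤`. [folklore] -/
theorem rel.le {closed : Bool} {a b : ℝ} (h : rel closed a b) : a ≤ b := by
  cases closed
  · exact le_of_lt h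
  · exact h

/-- `{rel φ ψ}` is measurable for measurable `φ, ψ`. [folklore] -/
theorem measurableSet_rel {X : Type*} [MeasurableSpace X] (closed : Bool) {φ ψ : X → ℝ}
    (hφ : Measurable φ) (hψ : Measurable ψ) : MeasurableSet {x | rel closed (φ x) (ψ x)} := by
  cases closed
  · exact measurableSet_lt hφ hψ
  · exact measurableSet_le hφ hψ

/-- **A graph-structured cell** (Polymath 8b, §7.4, display (graph), iterated once more):
`{a₀ ≶ t_i ≶ a₁, l₁(t_i) ≶ t_mid ≶ h₁(t_i), l₂(t_i, t_mid) ≶ t_inn ≶ h₂(t_i, t_mid)}` in `ℝ³ = (Fin 3 → ℝ)`,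
where the outer coordinate is `i`, the middle one `mid = i.succAbove j` and the inner one
`inn = i.succAbove (j.succAbove 0)`; all bounds affine with rational coefficients. [cite: Polymath8b2014, Section 7.4] -/
structure GCell where
  /-- outer coordinate -/
  i : Fin 3
  /-- position of the middle coordinate among the two remaining ones -/
  j : Fin 2
  /-- lower bound of the outer coordinate -/
  a0 : ℚ
  /-- upper bound of the outer coordinate -/
  a1 : ℚ
  /-- lower bound of the middle coordinate (affine in the outer one) -/
  l1 : Aff1
  /-- upper bound of the middle coordinate -/
  h1 : Aff1
  /-- lower bound of the inner coordinate (affine in the outer and middle ones) -/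
  l2 : Aff2
  /-- upper bound of the inner coordinate -/
  h2 : Aff2
deriving DecidableEq

namespace GCell

variable (c : GCell)

/-- The middle coordinate. [folklore] -/
def mid : Fin 3 := c.i.succAbove c.j

/-- The inner coordinate. [folklore] -/
def inn : Fin 3 := c.i.succAbove (c.j.succAbove 0)

/-- The cell as a subset of `ℝ³`, open (`closed = false`) or closed (`closed = true`).
[cite: Polymath8b2014, Section 7.4] -/
def set (closed : Bool) : Set (Fin 3 → ℝ) :=
  {t | (rel closed c.a0 (t c.i) ∧ rel closed (t c.i) c.a1) ∧
       (rel closed (c.l1.val (t c.i)) (t c.mid) ∧ rel closed (t c.mid) (c.h1.val (t c.i))) ∧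
       (rel closed (c.l2.val (t c.i) (t c.mid)) (t c.inn) ∧
        rel closed (t c.inn) (c.h2.val (t c.i) (t c.mid)))}

/-- **Well-formedness** (the bounds are correctly oriented on the cell): seven rational inequalities at
the corners, as a Boolean test (evaluated by `decide`). [folklore] -/
def wf : Bool :=
  decide (c.a0 ≤ c.a1 ∧ c.l1.qval c.a0 ≤ c.h1.qval c.a0 ∧ c.l1.qval c.a1 ≤ c.h1.qval c.a1 ∧
    c.l2.qval c.a0 (c.l1.qval c.a0) ≤ c.h2.qval c.a0 (c.l1.qval c.a0) ∧
    c.l2.qval c.a0 (c.h1.qval c.a0) ≤ c.h2.qval c.a0 (c.h1.qval c.a0) ∧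
    c.l2.qval c.a1 (c.l1.qval c.a1) ≤ c.h2.qval c.a1 (c.l1.qval c.a1) ∧
    c.l2.qval c.a1 (c.h1.qval c.a1) ≤ c.h2.qval c.a1 (c.h1.qval c.a1))

/-- The seven corner inequalities encoded by `wf`. [folklore] -/
theorem wf_spec {c : GCell} (h : c.wf = true) :
    c.a0 ≤ c.a1 ∧ c.l1.qval c.a0 ≤ c.h1.qval c.a0 ∧ c.l1.qval c.a1 ≤ c.h1.qval c.a1 ∧
    c.l2.qval c.a0 (c.l1.qval c.a0) ≤ c.h2.qval c.a0 (c.l1.qval c.a0) ∧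
    c.l2.qval c.a0 (c.h1.qval c.a0) ≤ c.h2.qval c.a0 (c.h1.qval c.a0) ∧
    c.l2.qval c.a1 (c.l1.qval c.a1) ≤ c.h2.qval c.a1 (c.l1.qval c.a1) ∧
    c.l2.qval c.a1 (c.h1.qval c.a1) ≤ c.h2.qval c.a1 (c.h1.qval c.a1) :=
  of_decide_eq_true h

/-- The exact integral of a `Q3` polynomial (in the cell's own variable order) over the cell.
[cite: Polymath8b2014, Section 7.4] -/
def integral (q : Q3) : ℚ :=
  cellIntegral q c.l2.toQ2 c.h2.toQ2 c.l1.toQ1 c.h1.toQ1 c.a0 c.a1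

variable {c}

/-- Oriented middle bounds inside the cell. [folklore] -/
theorem l1_le_h1 (h : c.wf = true) {u : ℝ} (h0 : (c.a0 : ℝ) ≤ u) (h1 : u ≤ c.a1) :
    c.l1.val u ≤ c.h1.val u := by
  obtain ⟨-, hA, hB, -⟩ := wf_spec h
  have hA' : (0 : ℝ) ≤ (c.h1.c0 - c.l1.c0) + (c.h1.c1 - c.l1.c1) * c.a0 := by
    have : ((c.l1.qval c.a0 : ℚ) : ℝ) ≤ c.h1.qval c.a0 := by exact_mod_cast hA
    simp only [Aff1.qval, Rat.cast_add, Rat.cast_mul] at this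
    linarith
  have hB' : (0 : ℝ) ≤ (c.h1.c0 - c.l1.c0) + (c.h1.c1 - c.l1.c1) * c.a1 := by
    have : ((c.l1.qval c.a1 : ℚ) : ℝ) ≤ c.h1.qval c.a1 := by exact_mod_cast hB
    simp only [Aff1.qval, Rat.cast_add, Rat.cast_mul] at this
    linarith
  have key := min_le_affine (A := (c.h1.c0 - c.l1.c0 : ℝ)) (B := (c.h1.c1 - c.l1.c1 : ℝ)) h0 h1
  have hmin : (0 : ℝ) ≤ min ((c.h1.c0 - c.l1.c0 : ℝ) + (c.h1.c1 - c.l1.c1) * c.a0)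
      ((c.h1.c0 - c.l1.c0 : ℝ) + (c.h1.c1 - c.l1.c1) * c.a1) := le_min hA' hB'
  simp only [Aff1.val]
  linarith

/-- Oriented inner bounds inside the cell. [folklore] -/
theorem l2_le_h2 (h : c.wf = true) {u v : ℝ} (h0 : (c.a0 : ℝ) ≤ u) (h1 : u ≤ c.a1)
    (h2 : c.l1.val u ≤ v) (h3 : v ≤ c.h1.val u) : c.l2.val u v ≤ c.h2.val u v := by
  obtain ⟨-, -, -, hLL, hLH, hHL, hHH⟩ := wf_spec h
  -- `g(u,v) := h2 - l2 = A + B u + C v`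
  set A : ℝ := c.h2.c0 - c.l2.c0 with hAdef
  set B : ℝ := c.h2.c1 - c.l2.c1 with hBdef
  set C : ℝ := c.h2.c2 - c.l2.c2 with hCdef
  have corner : ∀ (a : ℚ) (b : Aff1), c.l2.qval a (b.qval a) ≤ c.h2.qval a (b.qval a) →
      (0 : ℝ) ≤ (A + C * b.c0) + (B + C * b.c1) * (a : ℝ) := by
    intro a b hab
    have : ((c.l2.qval a (b.qval a) : ℚ) : ℝ) ≤ c.h2.qval a (b.qval a) := by exact_mod_cast hab
    simp only [Aff2.qval, Aff1.qval, Rat.cast_add, Rat.cast_mul] at this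
    simp only [hAdef, hBdef, hCdef]
    linarith
  -- along the lower and upper middle boundary, `g` is affine in `u` and nonnegative at `a0, a1`
  have low : (0 : ℝ) ≤ (A + C * c.l1.c0) + (B + C * c.l1.c1) * u := by
    have k := min_le_affine (A := A + C * c.l1.c0) (B := B + C * c.l1.c1) h0 h1
    have := le_min (corner c.a0 c.l1 hLL) (corner c.a1 c.l1 hHL)
    linarith
  have upp : (0 : ℝ) ≤ (A + C * c.h1.c0) + (B + C * c.h1.c1) * u := by
    have k := min_le_affine (A := A + C * c.h1.c0) (B := B + C * c.h1.c1) h0 h1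
    have := le_min (corner c.a0 c.h1 hLH) (corner c.a1 c.h1 hHH)
    linarith
  -- `g(u, ·)` is affine in `v ∈ [l1 u, h1 u]`
  have k := min_le_affine (A := A + B * u) (B := C) h2 h3
  have hmin : (0 : ℝ) ≤ min (A + B * u + C * c.l1.val u) (A + B * u + C * c.h1.val u) := by
    refine le_min ?_ ?_
    · simp only [Aff1.val]; linarith
    · simp only [Aff1.val]; linarith
  simp only [Aff2.val, hAdef, hBdef, hCdef] at k hmin ⊢
  linarith

/-! ### Boundedness and measurability of a cell -/

/-- Composite of an `Aff2` with an `Aff1` in the second argument: again affine in `u`. [folklore] -/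
theorem _root_.Literature.NumberTheory.Sieve.GEHCutoff.Aff2.val_comp (a : Aff2) (b : Aff1) (u : ℝ) :
    a.val u (b.val u) = ((a.c0 : ℝ) + a.c2 * b.c0) + ((a.c1 : ℝ) + a.c2 * b.c1) * u := by
  simp only [Aff2.val, Aff1.val]
  ring

/-- Corner value, as a real number. [folklore] -/
theorem _root_.Literature.NumberTheory.Sieve.GEHCutoff.Aff2.val_corner (a : Aff2) (b : Aff1) (r : ℚ) :
    ((a.c0 : ℝ) + a.c2 * b.c0) + ((a.c1 : ℝ) + a.c2 * b.c1) * r = (a.qval r (b.qval r) : ℝ) := by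
  simp only [Aff2.qval, Aff1.qval, Rat.cast_add, Rat.cast_mul]
  ring

/-- Lower corner bound for an affine function of `(u, v)` on the polygon
`{a₀ ≤ u ≤ a₁, l₁(u) ≤ v ≤ h₁(u)}`. [folklore] -/
theorem corner_le (a : Aff2) {a0 a1 : ℚ} {l1 h1 : Aff1} {u v : ℝ} (h0 : (a0 : ℝ) ≤ u) (h1' : u ≤ a1)
    (h2 : l1.val u ≤ v) (h3 : v ≤ h1.val u) :
    ((min (min (a.qval a0 (l1.qval a0)) (a.qval a1 (l1.qval a1)))
        (min (a.qval a0 (h1.qval a0)) (a.qval a1 (h1.qval a1))) : ℚ) : ℝ) ≤ a.val u v := by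
  have kv := min_le_affine (A := (a.c0 : ℝ) + a.c1 * u) (B := (a.c2 : ℝ)) h2 h3
  have kl := min_le_affine (A := (a.c0 : ℝ) + a.c2 * l1.c0) (B := (a.c1 : ℝ) + a.c2 * l1.c1) h0 h1'
  have kh := min_le_affine (A := (a.c0 : ℝ) + a.c2 * h1.c0) (B := (a.c1 : ℝ) + a.c2 * h1.c1) h0 h1'
  rw [Aff2.val_corner, Aff2.val_corner, ← Aff2.val_comp] at kl kh
  push_cast
  simp only [Aff2.val] at kv kl kh ⊢
  have e1 : (a.c0 : ℝ) + a.c1 * u + a.c2 * l1.val u = a.c0 + a.c1 * u + a.c2 * l1.val u := rfl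
  rw [min_le_iff] at kv
  rcases kv with kv | kv
  · rw [min_le_iff] at kl
    rcases kl with kl | kl
    · linarith [min_le_left (min ((a.qval a0 (l1.qval a0) : ℚ) : ℝ) (a.qval a1 (l1.qval a1)))
        (min ((a.qval a0 (h1.qval a0) : ℚ) : ℝ) (a.qval a1 (h1.qval a1))),
        min_le_left ((a.qval a0 (l1.qval a0) : ℚ) : ℝ) (a.qval a1 (l1.qval a1))]
    · linarith [min_le_left (min ((a.qval a0 (l1.qval a0) : ℚ) : ℝ) (a.qval a1 (l1.qval a1)))
        (min ((a.qval a0 (h1.qval a0) : ℚ) : ℝ) (a.qval a1 (h1.qval a1))),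
        min_le_right ((a.qval a0 (l1.qval a0) : ℚ) : ℝ) (a.qval a1 (l1.qval a1))]
  · rw [min_le_iff] at kh
    rcases kh with kh | kh
    · linarith [min_le_right (min ((a.qval a0 (l1.qval a0) : ℚ) : ℝ) (a.qval a1 (l1.qval a1)))
        (min ((a.qval a0 (h1.qval a0) : ℚ) : ℝ) (a.qval a1 (h1.qval a1))),
        min_le_left ((a.qval a0 (h1.qval a0) : ℚ) : ℝ) (a.qval a1 (h1.qval a1))]
    · linarith [min_le_right (min ((a.qval a0 (l1.qval a0) : ℚ) : ℝ) (a.qval a1 (l1.qval a1)))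
        (min ((a.qval a0 (h1.qval a0) : ℚ) : ℝ) (a.qval a1 (h1.qval a1))),
        min_le_right ((a.qval a0 (h1.qval a0) : ℚ) : ℝ) (a.qval a1 (h1.qval a1))]

/-- Upper corner bound (the lower bound for `-a`). [folklore] -/
theorem le_corner (a : Aff2) {a0 a1 : ℚ} {l1 h1 : Aff1} {u v : ℝ} (h0 : (a0 : ℝ) ≤ u) (h1' : u ≤ a1)
    (h2 : l1.val u ≤ v) (h3 : v ≤ h1.val u) :
    a.val u v ≤ -((min (min ((⟨-a.c0, -a.c1, -a.c2⟩ : Aff2).qval a0 (l1.qval a0))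
        ((⟨-a.c0, -a.c1, -a.c2⟩ : Aff2).qval a1 (l1.qval a1)))
        (min ((⟨-a.c0, -a.c1, -a.c2⟩ : Aff2).qval a0 (h1.qval a0))
          ((⟨-a.c0, -a.c1, -a.c2⟩ : Aff2).qval a1 (h1.qval a1))) : ℚ) : ℝ) := by
  have := corner_le ⟨-a.c0, -a.c1, -a.c2⟩ h0 h1' h2 h3
  have e : (⟨-a.c0, -a.c1, -a.c2⟩ : Aff2).val u v = -a.val u v := by
    simp only [Aff2.val]; push_cast; ring
  rw [e] at this
  linarith

/-- Lower bound of the middle coordinate. [folklore] -/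
def midLo : ℚ := min (c.l1.qval c.a0) (c.l1.qval c.a1)
/-- Upper bound of the middle coordinate. [folklore] -/
def midHi : ℚ := max (c.h1.qval c.a0) (c.h1.qval c.a1)
/-- Lower bound of the inner coordinate. [folklore] -/
def innLo : ℚ := min (min (c.l2.qval c.a0 (c.l1.qval c.a0)) (c.l2.qval c.a1 (c.l1.qval c.a1)))
  (min (c.l2.qval c.a0 (c.h1.qval c.a0)) (c.l2.qval c.a1 (c.h1.qval c.a1)))
/-- Upper bound of the inner coordinate. [folklore] -/
def innHi : ℚ := -(min (min ((⟨-c.h2.c0, -c.h2.c1, -c.h2.c2⟩ : Aff2).qval c.a0 (c.l1.qval c.a0))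
    ((⟨-c.h2.c0, -c.h2.c1, -c.h2.c2⟩ : Aff2).qval c.a1 (c.l1.qval c.a1)))
    (min ((⟨-c.h2.c0, -c.h2.c1, -c.h2.c2⟩ : Aff2).qval c.a0 (c.h1.qval c.a0))
      ((⟨-c.h2.c0, -c.h2.c1, -c.h2.c2⟩ : Aff2).qval c.a1 (c.h1.qval c.a1))))

/-- The bounding box of a cell: lower ends. [folklore] -/
def boxLo (k : Fin 3) : ℝ := if k = c.i then (c.a0 : ℝ) else if k = c.mid then (c.midLo : ℝ) else (c.innLo : ℝ)
/-- The bounding box of a cell: upper ends. [folklore] -/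
def boxHi (k : Fin 3) : ℝ := if k = c.i then (c.a1 : ℝ) else if k = c.mid then (c.midHi : ℝ) else (c.innHi : ℝ)

/-- `mid ≠ i`. [folklore] -/
theorem mid_ne_i : c.mid ≠ c.i := Fin.succAbove_ne _ _
/-- `inn ≠ i`. [folklore] -/
theorem inn_ne_i : c.inn ≠ c.i := Fin.succAbove_ne _ _
/-- `inn ≠ mid`. [folklore] -/
theorem inn_ne_mid : c.inn ≠ c.mid := by
  intro h
  have := Fin.succAbove_right_injective h
  exact Fin.succAbove_ne _ _ this

/-- Every coordinate of `Fin 3` is the outer, the middle or the inner one. [folklore] -/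
theorem eq_i_or_mid_or_inn (k : Fin 3) : k = c.i ∨ k = c.mid ∨ k = c.inn := by
  rcases Fin.eq_self_or_eq_succAbove c.i k with h | ⟨k', rfl⟩
  · exact Or.inl h
  · rcases Fin.eq_self_or_eq_succAbove c.j k' with h' | ⟨k'', rfl⟩
    · exact Or.inr (Or.inl (by rw [h']; rfl))
    · refine Or.inr (Or.inr ?_)
      have : k'' = 0 := Subsingleton.elim _ _
      subst this
      rfl

/-- **A cell lies in its bounding box.** [folklore] -/
theorem subset_box (closed : Bool) : c.set closed ⊆ Set.pi Set.univ fun k => Set.Icc (c.boxLo k) (c.boxHi k) := by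
  intro t ht
  obtain ⟨⟨h0, h1⟩, ⟨h2, h3⟩, ⟨h4, h5⟩⟩ := ht
  replace h0 := h0.le; replace h1 := h1.le; replace h2 := h2.le; replace h3 := h3.le
  replace h4 := h4.le; replace h5 := h5.le
  simp only [Set.mem_univ_pi, Set.mem_Icc]
  intro k
  rcases c.eq_i_or_mid_or_inn k with rfl | rfl | rfl
  · simp only [boxLo, boxHi, if_true]
    exact ⟨h0, h1⟩
  · simp only [boxLo, boxHi, if_neg c.mid_ne_i, if_true]
    constructor
    · have k := min_le_affine (A := (c.l1.c0 : ℝ)) (B := (c.l1.c1 : ℝ)) h0 h1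
      simp only [midLo, Rat.cast_min, Aff1.qval, Rat.cast_add, Rat.cast_mul]
      simp only [Aff1.val] at h2
      linarith
    · have k := affine_le_max (A := (c.h1.c0 : ℝ)) (B := (c.h1.c1 : ℝ)) h0 h1
      simp only [midHi, Rat.cast_max, Aff1.qval, Rat.cast_add, Rat.cast_mul]
      simp only [Aff1.val] at h3
      linarith
  · simp only [boxLo, boxHi, if_neg c.inn_ne_i, if_neg c.inn_ne_mid]
    constructor
    · have := corner_le c.l2 h0 h1 h2 h3
      simp only [innLo]
      linarith
    · have := le_corner c.h2 h0 h1 h2 h3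
      simp only [innHi]
      push_cast at this ⊢
      linarith

/-- The bounding box is compact. [folklore] -/
theorem isCompact_box : IsCompact (Set.pi Set.univ fun k => Set.Icc (c.boxLo k) (c.boxHi k)) :=
  isCompact_univ_pi fun _ => isCompact_Icc

/-- A cell is measurable. [folklore] -/
theorem measurableSet_set (closed : Bool) : MeasurableSet (c.set closed) := by
  have hi : Measurable fun t : Fin 3 → ℝ => t c.i := measurable_pi_apply _
  have hm : Measurable fun t : Fin 3 → ℝ => t c.mid := measurable_pi_apply _
  have hn : Measurable fun t : Fin 3 → ℝ => t c.inn := measurable_pi_apply _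
  have hl1 : Measurable fun t : Fin 3 → ℝ => c.l1.val (t c.i) := c.l1.continuous_val.measurable.comp hi
  have hh1 : Measurable fun t : Fin 3 → ℝ => c.h1.val (t c.i) := c.h1.continuous_val.measurable.comp hi
  have hl2 : Measurable fun t : Fin 3 → ℝ => c.l2.val (t c.i) (t c.mid) :=
    (measurable_const.add (measurable_const.mul hi)).add (measurable_const.mul hm)
  have hh2 : Measurable fun t : Fin 3 → ℝ => c.h2.val (t c.i) (t c.mid) :=
    (measurable_const.add (measurable_const.mul hi)).add (measurable_const.mul hm)
  simp only [set, Set.setOf_and]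
  exact ((measurableSet_rel closed measurable_const hi).inter (measurableSet_rel closed hi measurable_const)).inter
    (((measurableSet_rel closed hl1 hm).inter (measurableSet_rel closed hm hh1)).inter
      ((measurableSet_rel closed hl2 hn).inter (measurableSet_rel closed hn hh2)))

/-- The (polynomial) integrand attached to a cell: `q` evaluated in the cell's variable order. [folklore] -/
def integrand (q : Q3) (t : Fin 3 → ℝ) : ℝ := ev3 (t c.i) (t c.mid) (t c.inn) q

/-- The integrand is continuous. [folklore] -/
theorem continuous_integrand (q : Q3) : Continuous (c.integrand q) :=
  continuous_ev3_comp (continuous_apply _) (continuous_apply _) (continuous_apply _) q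

/-- **Integrability**: the indicator of a cell times a polynomial is integrable on `ℝ³`. [folklore] -/
theorem integrable_indicator (closed : Bool) (q : Q3) :
    MeasureTheory.Integrable ((c.set closed).indicator (c.integrand q)) := by
  rw [MeasureTheory.integrable_indicator_iff (c.measurableSet_set closed)]
  exact ((c.continuous_integrand q).continuousOn.integrableOn_compact c.isCompact_box).mono_set
    (c.subset_box closed)

/-! ### One-dimensional pieces of the Fubini computation -/

/-- `{rel lo w ∧ rel w hi}` is measurable. [folklore] -/
theorem measurableSet_relInterval (closed : Bool) (lo hi : ℝ) :
    MeasurableSet {w : ℝ | rel closed lo w ∧ rel closed w hi} := by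
  simp only [Set.setOf_and]
  exact (measurableSet_rel closed measurable_const measurable_id).inter
    (measurableSet_rel closed measurable_id measurable_const)

/-- Integrating over `{rel lo w ∧ rel w hi}` (an `Ioo` or an `Icc`) is the interval integral. [folklore] -/
theorem setIntegral_relInterval (closed : Bool) {lo hi : ℝ} (hle : lo ≤ hi) (g : ℝ → ℝ) :
    ∫ w in {w : ℝ | rel closed lo w ∧ rel closed w hi}, g w = ∫ w in lo..hi, g w := by
  cases closed
  · have : {w : ℝ | rel false lo w ∧ rel false w hi} = Set.Ioo lo hi := by
      ext w; simp [rel, Set.mem_Ioo]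
    rw [this, intervalIntegral.integral_of_le hle, MeasureTheory.integral_Ioc_eq_integral_Ioo]
  · have : {w : ℝ | rel true lo w ∧ rel true w hi} = Set.Icc lo hi := by
      ext w; simp [rel, Set.mem_Icc]
    rw [this, intervalIntegral.integral_of_le hle, MeasureTheory.integral_Icc_eq_integral_Ioc]

open Classical in
/-- Integral of a function supported in `{rel lo w ∧ rel w hi}` and equal to `g` there. [folklore] -/
theorem integral_eq_intervalIntegral_of_rel (closed : Bool) {lo hi : ℝ} (hle : lo ≤ hi) {f g : ℝ → ℝ}
    (hf : ∀ w, f w = if rel closed lo w ∧ rel closed w hi then g w else 0) :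
    ∫ w, f w = ∫ w in lo..hi, g w := by
  have : f = {w : ℝ | rel closed lo w ∧ rel closed w hi}.indicator g := by
    funext w
    rw [hf w, Set.indicator_apply]
    simp only [Set.mem_setOf_eq]
  rw [this, MeasureTheory.integral_indicator (measurableSet_relInterval closed lo hi),
    setIntegral_relInterval closed hle]

/-- Integral of a function that vanishes identically. [folklore] -/
theorem integral_eq_zero_of_forall {X : Type*} [MeasurableSpace X] {μ : MeasureTheory.Measure X}
    {f : X → ℝ} (hf : ∀ x, f x = 0) : ∫ x, f x ∂μ = 0 := by
  have : f = fun _ => 0 := funext hf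
  rw [this, MeasureTheory.integral_zero]

/-! ### The point with prescribed coordinates and the Fubini reduction -/

/-- The point of `ℝ³` with outer coordinate `u`, middle `v`, inner `w`. [folklore] -/
def pt (u v w : ℝ) : Fin 3 → ℝ := c.i.insertNth u (c.j.insertNth v (fun _ : Fin 1 => w))

/-- Outer coordinate of `pt`. [folklore] -/
@[simp] theorem pt_i (u v w : ℝ) : c.pt u v w c.i = u := by simp [pt]

/-- Middle coordinate of `pt`. [folklore] -/
@[simp] theorem pt_mid (u v w : ℝ) : c.pt u v w c.mid = v := by simp [pt, mid]

/-- Inner coordinate of `pt`. [folklore] -/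
@[simp] theorem pt_inn (u v w : ℝ) : c.pt u v w c.inn = w := by simp [pt, inn]

open Classical in
/-- The indicator integrand at `pt u v w`. [folklore] -/
theorem indicator_pt (closed : Bool) (q : Q3) (u v w : ℝ) :
    (c.set closed).indicator (c.integrand q) (c.pt u v w) =
      if (rel closed (c.a0 : ℝ) u ∧ rel closed u c.a1) ∧ (rel closed (c.l1.val u) v ∧ rel closed v (c.h1.val u)) ∧
          (rel closed (c.l2.val u v) w ∧ rel closed w (c.h2.val u v)) then ev3 u v w q else 0 := by
  rw [Set.indicator_apply]
  simp only [set, Set.mem_setOf_eq, pt_i, pt_mid, pt_inn, integrand]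

open MeasureTheory Classical in
/-- **Fubini for a graph-structured cell**: the integral over `ℝ³` of the indicator of the cell times a
polynomial equals the exact rational `GCell.integral` (Polymath 8b, §7.4: the displayed iterated
integrals `I(F↾P)`).  Valid for open and for closed cells. [cite: Polymath8b2014, Section 7.4] -/
theorem integral_indicator_eq (h : c.wf = true) (closed : Bool) (q : Q3) :
    ∫ t, (c.set closed).indicator (c.integrand q) t = (c.integral q : ℝ) := by
  set f : (Fin 3 → ℝ) → ℝ := (c.set closed).indicator (c.integrand q) with hf_def
  have hf : Integrable f := c.integrable_indicator closed q
  -- the three one-dimensional stages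
  set Φ₂ : ℝ → ℝ → ℝ := fun u v => ev2 u v (ops2.lint q c.l2.toQ2 c.h2.toQ2) with hΦ₂
  set Φ₁ : ℝ → ℝ := fun u => ev1 u (ops1.lint (ops2.lint q c.l2.toQ2 c.h2.toQ2) c.l1.toQ1 c.h1.toQ1)
    with hΦ₁
  -- innermost
  have L1 : ∀ u v, ∫ w, f (c.pt u v w) =
      if (rel closed (c.a0 : ℝ) u ∧ rel closed u c.a1) ∧ (rel closed (c.l1.val u) v ∧ rel closed v (c.h1.val u))
        then Φ₂ u v else 0 := by
    intro u v
    by_cases hP : (rel closed (c.a0 : ℝ) u ∧ rel closed u c.a1) ∧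
        (rel closed (c.l1.val u) v ∧ rel closed v (c.h1.val u))
    · rw [if_pos hP]
      have hle : c.l2.val u v ≤ c.h2.val u v := l2_le_h2 h hP.1.1.le hP.1.2.le hP.2.1.le hP.2.2.le
      rw [integral_eq_intervalIntegral_of_rel closed hle (g := fun w => ev3 u v w q)]
      · show ∫ w in c.l2.val u v..c.h2.val u v, ev3 u v w q = ev2 u v (ops2.lint q c.l2.toQ2 c.h2.toQ2)
        rw [← Aff2.ev2_toQ2, ← Aff2.ev2_toQ2]
        exact integral_leval (lawful2 u v) q c.l2.toQ2 c.h2.toQ2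
      · intro w
        rw [hf_def, c.indicator_pt closed q u v w]
        by_cases hw : rel closed (c.l2.val u v) w ∧ rel closed w (c.h2.val u v)
        · rw [if_pos ⟨hP.1, hP.2, hw⟩, if_pos hw]
        · rw [if_neg (fun H => hw H.2.2), if_neg hw]
    · rw [if_neg hP]
      refine integral_eq_zero_of_forall fun w => ?_
      rw [hf_def, c.indicator_pt closed q u v w, if_neg (fun H => hP ⟨H.1, H.2.1⟩)]
  -- middle
  have L2 : ∀ u, ∫ v, ∫ w, f (c.pt u v w) = if rel closed (c.a0 : ℝ) u ∧ rel closed u c.a1 then Φ₁ u else 0 := by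
    intro u
    simp_rw [L1 u]
    by_cases hP : rel closed (c.a0 : ℝ) u ∧ rel closed u c.a1
    · rw [if_pos hP]
      have hle : c.l1.val u ≤ c.h1.val u := l1_le_h1 h hP.1.le hP.2.le
      rw [integral_eq_intervalIntegral_of_rel closed hle (g := Φ₂ u)]
      · show ∫ v in c.l1.val u..c.h1.val u, ev2 u v (ops2.lint q c.l2.toQ2 c.h2.toQ2) =
          ev1 u (ops1.lint (ops2.lint q c.l2.toQ2 c.h2.toQ2) c.l1.toQ1 c.h1.toQ1)
        rw [← Aff1.ev1_toQ1, ← Aff1.ev1_toQ1]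
        exact integral_leval (lawful1 u) _ c.l1.toQ1 c.h1.toQ1
      · intro v
        by_cases hv : rel closed (c.l1.val u) v ∧ rel closed v (c.h1.val u)
        · rw [if_pos ⟨hP, hv⟩, if_pos hv]
        · rw [if_neg (fun H => hv H.2), if_neg hv]
    · rw [if_neg hP]
      refine integral_eq_zero_of_forall fun v => ?_
      rw [if_neg (fun H => hP H.1)]
  -- outer
  have L3 : ∫ u, (if rel closed (c.a0 : ℝ) u ∧ rel closed u c.a1 then Φ₁ u else 0) = (c.integral q : ℝ) := by
    have hle : (c.a0 : ℝ) ≤ c.a1 := by exact_mod_cast (wf_spec h).1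
    rw [integral_eq_intervalIntegral_of_rel closed hle (g := Φ₁) (fun u => rfl), hΦ₁, integral, cellIntegral,
      ← integral_leval ratOps_lawful _ c.a0 c.a1]
    rfl
  -- Fubini, stage 1: `ℝ³ ≃ ℝ × ℝ²`
  set e1 := MeasurableEquiv.piFinSuccAbove (fun _ : Fin 3 => ℝ) c.i with he1_def
  have he1 : MeasurePreserving e1 volume volume := volume_preserving_piFinSuccAbove (fun _ : Fin 3 => ℝ) c.i
  have hA : ∫ t, f t = ∫ p : ℝ × (Fin 2 → ℝ), f (c.i.insertNth p.1 p.2) :=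
    (he1.symm.integral_comp' f).symm
  have hfA : Integrable (fun p : ℝ × (Fin 2 → ℝ) => f (c.i.insertNth p.1 p.2))
      ((volume : Measure ℝ).prod (volume : Measure (Fin 2 → ℝ))) := by
    have := (he1.symm.integrable_comp_emb e1.symm.measurableEmbedding).2 hf
    rwa [Measure.volume_eq_prod] at this
  rw [hA, Measure.volume_eq_prod, integral_prod _ hfA]
  -- Fubini, stage 2: `ℝ² ≃ ℝ × ℝ¹ ≃ ℝ × ℝ`, for every `u` with integrable slice
  have hB : ∀ u, Integrable (fun t' : Fin 2 → ℝ => f (c.i.insertNth u t')) →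
      ∫ t', f (c.i.insertNth u t') = ∫ v, ∫ w, f (c.pt u v w) := by
    intro u hu
    set e2 := MeasurableEquiv.piFinSuccAbove (fun _ : Fin 2 => ℝ) c.j with he2_def
    have he2 : MeasurePreserving e2 volume volume := volume_preserving_piFinSuccAbove (fun _ : Fin 2 => ℝ) c.j
    have h1 : ∫ t', f (c.i.insertNth u t') =
        ∫ p : ℝ × (Fin 1 → ℝ), f (c.i.insertNth u (c.j.insertNth p.1 p.2)) :=
      (he2.symm.integral_comp' (fun t' => f (c.i.insertNth u t'))).symm
    have hu2 : Integrable (fun p : ℝ × (Fin 1 → ℝ) => f (c.i.insertNth u (c.j.insertNth p.1 p.2)))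
        ((volume : Measure ℝ).prod (volume : Measure (Fin 1 → ℝ))) := by
      have := (he2.symm.integrable_comp_emb e2.symm.measurableEmbedding).2 hu
      rwa [Measure.volume_eq_prod] at this
    rw [h1, Measure.volume_eq_prod, integral_prod _ hu2]
    refine integral_congr_ae (Filter.Eventually.of_forall fun v => ?_)
    have h3 := (volume_preserving_funUnique (Fin 1) ℝ).integral_comp' (fun w : ℝ => f (c.pt u v w))
    refine Eq.trans ?_ h3
    refine integral_congr_ae (Filter.Eventually.of_forall fun s => ?_)
    have hs : s = fun _ : Fin 1 => s 0 := funext fun k => by rw [Subsingleton.elim k 0]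
    simp only [pt, MeasurableEquiv.funUnique_apply]
    conv_lhs => rw [hs]
    rfl
  -- assemble
  have hae := hfA.prod_right_ae
  have key : ∫ u, ∫ t', f (c.i.insertNth u t') =
      ∫ u, (if rel closed (c.a0 : ℝ) u ∧ rel closed u c.a1 then Φ₁ u else 0) := by
    refine integral_congr_ae (hae.mono fun u hu => ?_)
    simp only at hu ⊢
    rw [hB u hu, L2 u]
  rw [key, L3]

end GCell

/-! ### Three further generic tools: permuting coordinates, null lines, piecewise fibre integrals -/

open MeasureTheory in
/-- **Permuting the coordinates preserves Lebesgue integrals on `ℝ³`** (used for the symmetric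
extension of the cutoff of Polymath 8b §7.4: `I(F) = 3! · I(F↾R_{xyz})`, `J(F) = 6(J₁ + ⋯ + J₈)`). [folklore] -/
theorem integral_comp_perm (σ : Equiv.Perm (Fin 3)) (g : (Fin 3 → ℝ) → ℝ) :
    ∫ t : Fin 3 → ℝ, g (fun k => t (σ k)) = ∫ t, g t := by
  have h := (volume_measurePreserving_piCongrLeft (fun _ : Fin 3 => ℝ) σ).symm
  exact h.integral_comp' g

open MeasureTheory in
/-- **Lines are Lebesgue-null in `ℝ²`**: `volume {a t₀ + b t₁ = c} = 0` when `(a, b) ≠ (0, 0)`. [folklore] -/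
theorem volume_line_eq_zero {a b : ℝ} (c : ℝ) (hab : a ≠ 0 ∨ b ≠ 0) :
    volume {t : Fin 2 → ℝ | a * t 0 + b * t 1 = c} = 0 := by
  -- the linear functional `ℓ(t) = a t₀ + b t₁`
  let ℓ : (Fin 2 → ℝ) →ₗ[ℝ] ℝ := a • LinearMap.proj 0 + b • LinearMap.proj 1
  have hℓ : ∀ t : Fin 2 → ℝ, ℓ t = a * t 0 + b * t 1 := fun t => by simp [ℓ]
  -- a base point on the line
  obtain ⟨p₀, hp₀⟩ : ∃ p₀ : Fin 2 → ℝ, a * p₀ 0 + b * p₀ 1 = c := by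
    rcases hab with ha | hb
    · exact ⟨![c / a, 0], by simp; field_simp⟩
    · exact ⟨![0, c / b], by simp; field_simp⟩
  let S : AffineSubspace ℝ (Fin 2 → ℝ) := AffineSubspace.mk' p₀ (LinearMap.ker ℓ)
  have hsub : {t : Fin 2 → ℝ | a * t 0 + b * t 1 = c} ⊆ (S : Set (Fin 2 → ℝ)) := by
    intro t ht
    simp only [Set.mem_setOf_eq] at ht
    show t ∈ S
    rw [AffineSubspace.mem_mk', LinearMap.mem_ker, vsub_eq_sub, map_sub, hℓ, hℓ, ht, hp₀, sub_self]
  have hS : S ≠ ⊤ := by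
    intro htop
    have hdir : LinearMap.ker ℓ = ⊤ := by
      have := congrArg AffineSubspace.direction htop
      rwa [AffineSubspace.direction_mk', AffineSubspace.direction_top] at this
    have h1 : ℓ ![1, 0] = 0 := LinearMap.mem_ker.1 (hdir ▸ Submodule.mem_top)
    have h2 : ℓ ![0, 1] = 0 := LinearMap.mem_ker.1 (hdir ▸ Submodule.mem_top)
    rw [hℓ] at h1 h2
    simp at h1 h2
    rcases hab with ha | hb
    · exact ha h1
    · exact hb h2
  exact measure_mono_null hsub (Measure.addHaar_affineSubspace volume S hS)

open MeasureTheory in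
/-- **A fibre integral from a piecewise description**: if `f` is integrable, agrees with `g_k` on
`(a_k, a_{k+1})` (`0 = a₀ ≤ a₁ ≤ ⋯ ≤ a_n`) and vanishes beyond `a_n`, then
`∫_{u>0} f = Σ_k ∫_{a_k}^{a_{k+1}} g_k` (the shape of the marginals `∫ F dz` of Polymath 8b §7.4,
displays `J₁`–`J₈` and (7.12)–(7.17)). [cite: Polymath8b2014, Section 7.4] -/
theorem setIntegral_Ioi_eq_sum_of_piecewise {f : ℝ → ℝ} (hf : Integrable f) {n : ℕ} (a : ℕ → ℝ)
    (g : ℕ → ℝ → ℝ) (h0 : a 0 = 0) (hmono : ∀ k < n, a k ≤ a (k + 1))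
    (heq : ∀ k < n, ∀ u ∈ Set.Ioo (a k) (a (k + 1)), f u = g k u) (hzero : ∀ u, a n < u → f u = 0) :
    ∫ u in Set.Ioi 0, f u = ∑ k ∈ Finset.range n, ∫ u in a k..a (k + 1), g k u := by
  have han : 0 ≤ a n := by
    have : ∀ m ≤ n, 0 ≤ a m := by
      intro m hm
      induction m with
      | zero => rw [h0]
      | succ m ih => exact (ih (Nat.le_of_succ_le hm)).trans (hmono m (Nat.lt_of_succ_le hm))
    exact this n le_rfl
  -- split `(0, ∞) = (0, a_n] ∪ (a_n, ∞)`
  have hsplit : Set.Ioi (0 : ℝ) = Set.Ioc 0 (a n) ∪ Set.Ioi (a n) := (Set.Ioc_union_Ioi_eq_Ioi han).symm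
  rw [hsplit, setIntegral_union (Set.Ioc_disjoint_Ioi le_rfl) measurableSet_Ioi hf.integrableOn hf.integrableOn]
  have htail : ∫ u in Set.Ioi (a n), f u = 0 := by
    rw [setIntegral_congr_fun measurableSet_Ioi (g := fun _ => (0 : ℝ)) fun u hu => hzero u hu]
    simp
  rw [htail, add_zero, ← intervalIntegral.integral_of_le han]
  have e0 : (∫ x in (0 : ℝ)..a n, f x) = ∫ x in a 0..a n, f x := by rw [h0]
  rw [e0, ← intervalIntegral.sum_integral_adjacent_intervals (fun k _ => hf.intervalIntegrable)]
  refine Finset.sum_congr rfl fun k hk => ?_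
  rw [Finset.mem_range] at hk
  -- `f = g_k` a.e. on the `k`-th interval (they may differ at the right endpoint only)
  refine intervalIntegral.integral_congr_ae ?_
  have hpt : ∀ᵐ u : ℝ, u ≠ a (k + 1) := by
    have : (volume : Measure ℝ) {a (k + 1)} = 0 := measure_singleton _
    exact (measure_eq_zero_iff_ae_notMem.1 this).mono fun u hu => by simpa using hu
  refine hpt.mono fun u hu hmem => ?_
  rw [Set.uIoc_of_le (hmono k hk), Set.mem_Ioc] at hmem
  exact heq k hk u ⟨hmem.1, lt_of_le_of_ne hmem.2 hu⟩


end GEHCutoff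

end Literature.NumberTheory.Sieve
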